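import Summits.ResolutionOfSingularities.ResolutionOfSingularities.Theorems.FrobeniusClosingSteerNonRationalWindowInitialForm
import Summits.ResolutionOfSingularities.ResolutionOfSingularities.Theorems.FrobeniusClosingSteerNonRationalWindowContraction
import Literature.AlgebraicGeometry.Resolution.LocalBlowup
import HarnessLib

/-!
# NRA-A run reading, FILE 2b: **the SUBRING BRIDGE** — from the parity bound at the local ring of the centre to «the dehomogenised initial
# form lies in `𝔮^d` for the MAXIMAL, NON-RATIONAL ideal `𝔮` of the centre in `κ(S)[T]`» (member level; Theses-free, def-free)

OURS (campaign `res-hironaka`, rung L ★L-G4, slot W4.1 · crux `Steer` (stmt-ResolutionOfSingularities-16345) · hARᵒ H2, residue word NRA-A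
`NonRationalWindow.NonRationalAWindowTwoN` (res-L0-w41-strat-2 g4); RULING 284(b)(3); plan `D/res-D-repro-2/NRA-A-RUNREADING-PLAN.md` step (3);
seat res-D-repro-2 g9). Over FILE 1 `exists_weakTransform_eq_initialForm`, FILE 2a (`exists_mul_eq_mul_add_of_sub_mul_sq_mem_pow`, `mem_pow_map_of_mul_eq`,
`symm_mem_comap_pow`) and the Literature localisation `locAtCentre` / `subringCentre` (NSp Def. 2.8). Not a statement of the manuscript under review
[claim: Hironaka2017, status: under-review]; AI-produced, weaker than expert review.

SETTING: `S ⊆ K` regular local with regular system `z` (`x := z 0 ≠ 0`), `B := S[𝔪/x] ⊆ O` (a valuation ring), `S′ := B_{𝔪_O ∩ B}` (`locAtCentre`),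
`𝔔 := 𝔪_O ∩ B` (`subringCentre`) assumed MAXIMAL (true for zero-dimensional `O`; discharged at run level), `ψ : κ(S)[T] ≅ B/(x)` the chart map of
`blowupRing_chartQuotient_X` (bijective), `𝔮 := ψ⁻¹(𝔔/(x))`.

* `isMaximal_centreChart` — `𝔮` is maximal.
* `exists_initialForm_mem_pow` — if the weak transform `F′` of `F ∈ 𝔪_S^d` satisfies `F′ − x·q² ∈ (𝔔S′)^d` for some `q ∈ S′` (the PARITY bound at
  the later member), then the dehomogenised initial form `g` of `F` lies in `𝔮^d` (and has total degree `≤ d`, `Φ(z) = F`).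
* `not_surjective_of_not_rational` — if the window is NOT residually rational in the value form (`∃ a ∈ S′, ∀ b ∈ S, ¬ v(a − b) < 1`) and `S` is
  dominated by `O`, then `κ(S) → κ(S)[T]/𝔮` is not surjective (the hypothesis shape of the BI-CONE word).
[cite: NovacoskiSpivakovsky2014, Def. 2.8] [cite: StacksProject, Tag 0BIQ] [folklore]
-/

noncomputable section

-- `Summit.<S>.<S>.…` duplicates the summit name by design (single-problem summit).
set_option linter.dupNamespace false

open IsLocalRing MvPolynomial

namespace Summit.ResolutionOfSingularities.ResolutionOfSingularities.Theorems.SwitchingDichotomy.NonRationalWindow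

open Literature.AlgebraicGeometry.Resolution

variable {K : Type} [Field K]

section bridge

variable (S : Subring K) [IsRegularLocalRing S] {n : ℕ} (z : Fin (n + 1) → S)
  (O : ValuationSubring K) (hBO : blowupRing S ((z 0 : S) : K) ≤ O.toSubring)
  (ψ : MvPolynomial {j : Fin (n + 1) // j ≠ 0} (ResidueField S) →+*
    blowupRing S ((z 0 : S) : K) ⧸ Ideal.span {(⟨((z 0 : S) : K), le_blowupRing S ((z 0 : S) : K) (z 0).2⟩ : blowupRing S ((z 0 : S) : K))})

/-- **`𝔮 := ψ⁻¹(𝔔/(x))` is maximal** when the centre `𝔔` is maximal (`x ∈ 𝔔`, `ψ` bijective). [folklore] -/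
theorem isMaximal_centreChart (hx𝔔 : (⟨((z 0 : S) : K), le_blowupRing S ((z 0 : S) : K) (z 0).2⟩ : blowupRing S ((z 0 : S) : K)) ∈
      subringCentre (blowupRing S ((z 0 : S) : K)) O hBO)
    (h𝔔max : (subringCentre (blowupRing S ((z 0 : S) : K)) O hBO).IsMaximal) (hψ : Function.Bijective ψ) :
    (((subringCentre (blowupRing S ((z 0 : S) : K)) O hBO).map (Ideal.Quotient.mk _)).comap ψ).IsMaximal := by
  set B := blowupRing S ((z 0 : S) : K)
  set 𝔔 := subringCentre B O hBO
  set mk := Ideal.Quotient.mk (Ideal.span {(⟨((z 0 : S) : K), le_blowupRing S ((z 0 : S) : K) (z 0).2⟩ : B)})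
  haveI : (𝔔.map mk).IsMaximal := by
    refine Ideal.IsMaximal.map_of_surjective_of_ker_le Ideal.Quotient.mk_surjective ?_
    rw [Ideal.mk_ker, Ideal.span_singleton_le_iff_mem]
    exact hx𝔔
  set ψe : _ ≃+* _ := RingEquiv.ofBijective ψ hψ
  have : (𝔔.map mk).comap ψ = (𝔔.map mk).comap ψe := rfl
  rw [this]
  exact Ideal.comap_isMaximal_of_equiv ψe

/-- **The dehomogenised initial form lies in `𝔮^d`.** See the module docstring. [folklore] -/
theorem exists_initialForm_mem_pow (hz : Ideal.span (Set.range z) = maximalIdeal S) (hz0 : ((z 0 : S) : K) ≠ 0)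
    (hx𝔔 : (⟨((z 0 : S) : K), le_blowupRing S ((z 0 : S) : K) (z 0).2⟩ : blowupRing S ((z 0 : S) : K)) ∈
      subringCentre (blowupRing S ((z 0 : S) : K)) O hBO)
    (h𝔔max : (subringCentre (blowupRing S ((z 0 : S) : K)) O hBO).IsMaximal) (hψ : Function.Bijective ψ)
    (hψC : ∀ s : S, ψ (MvPolynomial.C (residue S s)) = Ideal.Quotient.mk _ ⟨(s : K), le_blowupRing S ((z 0 : S) : K) s.2⟩)
    (hψX : ∀ (j : {j : Fin (n + 1) // j ≠ 0}) (h : ((z j.1 : S) : K) / ((z 0 : S) : K) ∈ blowupRing S ((z 0 : S) : K)),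
      ψ (MvPolynomial.X j) = Ideal.Quotient.mk _ ⟨((z j.1 : S) : K) / ((z 0 : S) : K), h⟩)
    {d : ℕ} {F : S} (hF : F ∈ maximalIdeal S ^ d)
    (hpar : ∀ F' : blowupRing S ((z 0 : S) : K), ((F' : blowupRing S ((z 0 : S) : K)) : K) * ((z 0 : S) : K) ^ d = (F : K) →
      ∃ q : locAtCentre (blowupRing S ((z 0 : S) : K)) O,
        algebraMap _ (locAtCentre (blowupRing S ((z 0 : S) : K)) O) F' -
          algebraMap _ (locAtCentre (blowupRing S ((z 0 : S) : K)) O)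
            (⟨((z 0 : S) : K), le_blowupRing S ((z 0 : S) : K) (z 0).2⟩ : blowupRing S ((z 0 : S) : K)) * q ^ 2 ∈
          ((subringCentre (blowupRing S ((z 0 : S) : K)) O hBO).map
            (algebraMap _ (locAtCentre (blowupRing S ((z 0 : S) : K)) O))) ^ d) :
    ∃ Φ : MvPolynomial (Fin (n + 1)) S, Φ.IsHomogeneous d ∧ MvPolynomial.eval z Φ = F ∧
      (MvPolynomial.map (residue S) (dehomogenize 0 Φ)).totalDegree ≤ d ∧
      MvPolynomial.map (residue S) (dehomogenize 0 Φ) ∈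
        (((subringCentre (blowupRing S ((z 0 : S) : K)) O hBO).map (Ideal.Quotient.mk _)).comap ψ) ^ d := by
  classical
  set 𝔔 := subringCentre (blowupRing S ((z 0 : S) : K)) O hBO with h𝔔
  set S' := locAtCentre (blowupRing S ((z 0 : S) : K)) O with hS'
  haveI : IsLocalRing S' := IsLocalization.AtPrime.isLocalRing S' 𝔔
  obtain ⟨Φ, F', hΦ, hΦev, hF'x, hF'mk, hdeg⟩ := exists_weakTransform_eq_initialForm S z hz hz0 ψ hψC hψX hF
  refine ⟨Φ, hΦ, hΦev, hdeg, ?_⟩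
  -- the parity bound at `S'`, in `maximalIdeal S'`
  obtain ⟨q, hq⟩ := hpar F' hF'x
  have hmax : 𝔔.map (algebraMap (blowupRing S ((z 0 : S) : K)) S') = maximalIdeal S' := IsLocalization.AtPrime.map_eq_maximalIdeal 𝔔 S'
  rw [hmax] at hq
  -- clear denominators
  obtain ⟨c, b, y, hc, hy, heq⟩ := exists_mul_eq_mul_add_of_sub_mul_sq_mem_pow 𝔔 (⟨((z 0 : S) : K), le_blowupRing S ((z 0 : S) : K) (z 0).2⟩ : blowupRing S ((z 0 : S) : K)) F' d ⟨q, hq⟩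
  -- modulo `x`
  haveI h𝔔bar : (𝔔.map (Ideal.Quotient.mk (Ideal.span {(⟨((z 0 : S) : K), le_blowupRing S ((z 0 : S) : K) (z 0).2⟩ : blowupRing S ((z 0 : S) : K))}))).IsMaximal := by
    refine Ideal.IsMaximal.map_of_surjective_of_ker_le Ideal.Quotient.mk_surjective ?_
    rw [Ideal.mk_ker, Ideal.span_singleton_le_iff_mem]
    exact hx𝔔
  have hcomap : (𝔔.map (Ideal.Quotient.mk (Ideal.span {(⟨((z 0 : S) : K), le_blowupRing S ((z 0 : S) : K) (z 0).2⟩ : blowupRing S ((z 0 : S) : K))}))).comap (Ideal.Quotient.mk (Ideal.span {(⟨((z 0 : S) : K), le_blowupRing S ((z 0 : S) : K) (z 0).2⟩ : blowupRing S ((z 0 : S) : K))})) = 𝔔 := by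
    rw [Ideal.comap_map_of_surjective _ Ideal.Quotient.mk_surjective, ← RingHom.ker_eq_comap_bot, Ideal.mk_ker, sup_eq_left,
      Ideal.span_singleton_le_iff_mem]
    exact hx𝔔
  have hmkx : (Ideal.Quotient.mk (Ideal.span {(⟨((z 0 : S) : K), le_blowupRing S ((z 0 : S) : K) (z 0).2⟩ : blowupRing S ((z 0 : S) : K))})) (⟨((z 0 : S) : K), le_blowupRing S ((z 0 : S) : K) (z 0).2⟩ : blowupRing S ((z 0 : S) : K)) = 0 := by
    rw [Ideal.Quotient.eq_zero_iff_mem]; exact Ideal.mem_span_singleton_self _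
  have hmemF : (Ideal.Quotient.mk (Ideal.span {(⟨((z 0 : S) : K), le_blowupRing S ((z 0 : S) : K) (z 0).2⟩ : blowupRing S ((z 0 : S) : K))})) F' ∈ (𝔔.map (Ideal.Quotient.mk (Ideal.span {(⟨((z 0 : S) : K), le_blowupRing S ((z 0 : S) : K) (z 0).2⟩ : blowupRing S ((z 0 : S) : K))}))) ^ d := mem_pow_map_of_mul_eq (Ideal.Quotient.mk (Ideal.span {(⟨((z 0 : S) : K), le_blowupRing S ((z 0 : S) : K) (z 0).2⟩ : blowupRing S ((z 0 : S) : K))})) 𝔔 hmkx h𝔔bar hcomap hc hy heq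
  -- transport along `ψ`
  set ψe : _ ≃+* _ := RingEquiv.ofBijective ψ hψ with hψe
  have hsymm : ψe.symm ((Ideal.Quotient.mk (Ideal.span {(⟨((z 0 : S) : K), le_blowupRing S ((z 0 : S) : K) (z 0).2⟩ : blowupRing S ((z 0 : S) : K))})) F') = MvPolynomial.map (residue S) (dehomogenize 0 Φ) := by
    rw [RingEquiv.symm_apply_eq]
    change (Ideal.Quotient.mk (Ideal.span {(⟨((z 0 : S) : K), le_blowupRing S ((z 0 : S) : K) (z 0).2⟩ : blowupRing S ((z 0 : S) : K))})) F' = ψ _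
    exact hF'mk
  have := symm_mem_comap_pow ψe (𝔔.map (Ideal.Quotient.mk (Ideal.span {(⟨((z 0 : S) : K), le_blowupRing S ((z 0 : S) : K) (z 0).2⟩ : blowupRing S ((z 0 : S) : K))}))) hmemF
  rw [hsymm] at this
  exact this

/-- **Non-rational window ⇒ `κ(S) → κ(S)[T]/𝔮` not surjective.** `S` dominated by `O`; value form of non-rationality. [folklore] -/
theorem not_surjective_of_not_rational (hSO : SubringDominates S O.toSubring)
    (hx𝔔 : (⟨((z 0 : S) : K), le_blowupRing S ((z 0 : S) : K) (z 0).2⟩ : blowupRing S ((z 0 : S) : K)) ∈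
      subringCentre (blowupRing S ((z 0 : S) : K)) O hBO)
    (hψ : Function.Bijective ψ)
    (hψC : ∀ s : S, ψ (MvPolynomial.C (residue S s)) = Ideal.Quotient.mk _ ⟨(s : K), le_blowupRing S ((z 0 : S) : K) s.2⟩)
    (hnr : ∃ a ∈ locAtCentre (blowupRing S ((z 0 : S) : K)) O, ∀ b ∈ S, ¬ O.valuation (a - b) < 1) :
    ¬ Function.Surjective (algebraMap (ResidueField S)
      (MvPolynomial {j : Fin (n + 1) // j ≠ 0} (ResidueField S) ⧸
        ((subringCentre (blowupRing S ((z 0 : S) : K)) O hBO).map (Ideal.Quotient.mk _)).comap ψ)) := by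
  classical
  set 𝔔 := subringCentre (blowupRing S ((z 0 : S) : K)) O hBO with h𝔔
  set 𝔮 := (𝔔.map (Ideal.Quotient.mk (Ideal.span {(⟨((z 0 : S) : K), le_blowupRing S ((z 0 : S) : K) (z 0).2⟩ : blowupRing S ((z 0 : S) : K))}))).comap ψ with h𝔮
  intro hsurj
  -- every `b ∈ B` is congruent to some `s ∈ S` modulo `𝔔`
  have hcomap : (𝔔.map (Ideal.Quotient.mk (Ideal.span {(⟨((z 0 : S) : K), le_blowupRing S ((z 0 : S) : K) (z 0).2⟩ : blowupRing S ((z 0 : S) : K))}))).comap (Ideal.Quotient.mk (Ideal.span {(⟨((z 0 : S) : K), le_blowupRing S ((z 0 : S) : K) (z 0).2⟩ : blowupRing S ((z 0 : S) : K))})) = 𝔔 := by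
    rw [Ideal.comap_map_of_surjective _ Ideal.Quotient.mk_surjective, ← RingHom.ker_eq_comap_bot, Ideal.mk_ker, sup_eq_left,
      Ideal.span_singleton_le_iff_mem]
    exact hx𝔔
  have happrox : ∀ b : blowupRing S ((z 0 : S) : K), ∃ s : S, O.valuation ((b : K) - (s : K)) < 1 := by
    intro b
    obtain ⟨r, hr⟩ := hsurj (Ideal.Quotient.mk 𝔮 ((RingEquiv.ofBijective ψ hψ).symm ((Ideal.Quotient.mk (Ideal.span {(⟨((z 0 : S) : K), le_blowupRing S ((z 0 : S) : K) (z 0).2⟩ : blowupRing S ((z 0 : S) : K))})) b)))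
    obtain ⟨s, rfl⟩ := residue_surjective (R := S) r
    -- `algebraMap κ (κ[T]/𝔮) (residue s) = mk𝔮 (C (residue s))`
    have e1 : algebraMap (ResidueField S) (MvPolynomial {j : Fin (n + 1) // j ≠ 0} (ResidueField S) ⧸ 𝔮) (residue S s) =
        Ideal.Quotient.mk 𝔮 (MvPolynomial.C (residue S s)) := rfl
    rw [e1, Ideal.Quotient.eq, h𝔮, Ideal.mem_comap, map_sub] at hr
    have e2 : ψ ((RingEquiv.ofBijective ψ hψ).symm ((Ideal.Quotient.mk (Ideal.span {(⟨((z 0 : S) : K), le_blowupRing S ((z 0 : S) : K) (z 0).2⟩ : blowupRing S ((z 0 : S) : K))})) b)) = (Ideal.Quotient.mk (Ideal.span {(⟨((z 0 : S) : K), le_blowupRing S ((z 0 : S) : K) (z 0).2⟩ : blowupRing S ((z 0 : S) : K))})) b :=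
      (RingEquiv.ofBijective ψ hψ).apply_symm_apply ((Ideal.Quotient.mk (Ideal.span {(⟨((z 0 : S) : K), le_blowupRing S ((z 0 : S) : K) (z 0).2⟩ : blowupRing S ((z 0 : S) : K))})) b)
    rw [hψC, e2, ← map_sub, ← Ideal.mem_comap, hcomap, mem_subringCentre_iff] at hr
    refine ⟨s, ?_⟩
    have : (((⟨(s : K), le_blowupRing S ((z 0 : S) : K) s.2⟩ : blowupRing S ((z 0 : S) : K)) - b : blowupRing S ((z 0 : S) : K)) : K) = (s : K) - (b : K) := rfl
    rw [this] at hr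
    rwa [← Valuation.map_neg, neg_sub] at hr
  -- the element `a = y / w`
  obtain ⟨a, ha, hab⟩ := hnr
  obtain ⟨y, hy, w, hw, hvw, rfl⟩ := (mem_locAtCentre_iff).mp ha
  obtain ⟨s₁, hs₁⟩ := happrox ⟨y, hy⟩
  obtain ⟨s₂, hs₂⟩ := happrox ⟨w, hw⟩
  simp only at hs₁ hs₂
  -- `v(s₂) = 1`, so `s₂` is a unit of `S`
  have hle : ∀ t : S, O.valuation (t : K) ≤ 1 := fun t => (O.valuation_le_one_iff _).mpr (hSO.1 t.2)
  have hvs₂ : O.valuation (s₂ : K) = 1 := by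
    have h1 : O.valuation ((s₂ : K) - w) < 1 := by rw [← Valuation.map_neg, neg_sub]; exact hs₂
    have : (s₂ : K) = w + ((s₂ : K) - w) := by ring
    rw [this, Valuation.map_add_eq_of_lt_left _ (by rw [hvw]; exact h1), hvw]
  have hs₂0 : (s₂ : K) ≠ 0 := ne_zero_of_valuation_eq_one hvs₂
  have hw0 : w ≠ 0 := ne_zero_of_valuation_eq_one hvw
  have hs₂inv : (s₂ : K)⁻¹ ∈ S := by
    have hO : (s₂ : K)⁻¹ ∈ O.toSubring := by
      rw [ValuationSubring.mem_toSubring, ← O.valuation_le_one_iff, map_inv₀, hvs₂, inv_one]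
    exact hSO.2 _ s₂.2 hO
  refine hab ((s₁ : K) * (s₂ : K)⁻¹) (S.mul_mem s₁.2 hs₂inv) ?_
  have e : y / w - (s₁ : K) * (s₂ : K)⁻¹ = ((y - s₁) * s₂ + s₁ * (s₂ - w)) / (w * s₂) := by
    field_simp
    ring
  rw [e, map_div₀, map_mul, hvw, hvs₂, one_mul, div_one]
  refine lt_of_le_of_lt (Valuation.map_add _ _ _) (max_lt ?_ ?_)
  · rw [map_mul, hvs₂, mul_one]; exact hs₁
  · rw [map_mul]
    calc O.valuation (s₁ : K) * O.valuation ((s₂ : K) - w) ≤ 1 * O.valuation ((s₂ : K) - w) :=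
          mul_le_mul_of_nonneg_right (hle s₁) zero_le
      _ < 1 := by rw [one_mul, ← Valuation.map_neg, neg_sub]; exact hs₂

end bridge

end Summit.ResolutionOfSingularities.ResolutionOfSingularities.Theorems.SwitchingDichotomy.NonRationalWindow

end
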